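import Summits.BirchSwinnertonDyer.BirchSwinnertonDyer.Theorems.KolyvaginRoadThreeSchneiderTamAtThreeHeightLogNumeratorExactProduct
import HarnessLib

/-!
# Crux `SchneiderTamAtThree` (item 19154) — THE HEIGHT IS THE LOGARITHM OF THE NUMERATOR, DEEP POINTS,
# part 7b: THE EXACT SECOND-ORDER LAW `ĥ₃(P) ≡ log₃ num x − κ_E·den x/num x (mod 3^{4k})`,
# `κ_E = (C⁻²·E₂(q) − b₂)/12` — precision `4k`, INDEPENDENT of the Kodaira type

HONEST FRAMING (cell `bsd-stepL`, seat `bsd-stepL-tam3-p2` g3, WIDTH-LEVER second lane «closed-form Schneider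
local factor at 3 … finite case table proved once»; `--supports stmt-BirchSwinnertonDyer-19154 --as helper`):
THEOREMS ONLY, unconditional, route-independent (no Theses import); 0 definitions, 0 named facts, 0 sorry;
nothing here proves the crux `SchneiderTamAtThree`, Schneider's conjecture or BSD.

* `norm_heightFourOneCoord_sub_padicLog_num_add_kappaE_mul_le` — for `W/ℚ` globally minimal with
  multiplicative reduction at `3`, ANY `q ∈ ℚ₃` with `‖q‖₃ < 1` and ANY rational point `P = (x, y)` of level
  `k ≥ 2` (`‖z(P)‖₃ ≤ 3⁻²`): **`‖ĥ₃(P) − log₃ num x + κ_E·den x/num x‖₃ ≤ ‖x‖₃⁻²`**, where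
  **`κ_E = (C⁻²·E₂(q) − b₂)/12`**, `E₂(q) = 1 − 24 s₁(q) = 1 − 24 Σ_{n≥1} σ₁(n)qⁿ = 1 − 24 Σ qⁿ/(1 − qⁿ)²`
  (tree `tateS 1 q`), `C² = uniformisationScaleSq W 3 q`. The precision `3^{−4k}` does NOT depend on
  `ν = v₃(q)`: the `q`-dependence of the second `3`-adic digit block of the height is carried EXACTLY by the
  single curve constant `κ_E ∈ ℤ₃` (the quasi-period constant: `E₂(q)/C²` is `12·s₂` for the Mazur–Tate
  `σ`-function of `(E, ω)`), and the deep-point laws of parts 3b/6/6b are its truncations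
  `κ_E ≡ −κ₀' (mod q)`, `κ_E ≡ −κ₀' − 60(c₆/c₄)q (mod q²)` (part 7c).
  Mechanism: as part 3b (`ĥ₃ − log₃ a = −log(xℓ²) − log(2(ch L − 1)/L) − log Π`), with the sigma product
  taken to ALL orders in `q` (part 7a: `log Π = −2 s₁(q)·L + O(L²)`), the scale `C⁻²` kept exact, and the
  conversion `ℓ² → x⁻¹` of part 3a′ run at the corrected scale `C' = C⁻²E₂(q)` (`‖C'‖ = 1`, `C' ≡ b₂ mod 3`).
  INSTRUMENT (seat numerics on lane A's REG3CERT table j249075, `numerics/check_kappaE.py`): `v₃(residual) ≥ 4k`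
  on 246/246 non-split rows of level `≥ 2` (equality on 170) and `≥ 4` on 444/444 rows of level 1 (equality on
  299) — the law is sharp, and numerically also holds at level 1 (not proved here: third order needed).

References: [SteinWuthrich2013] §4.1 (4.1), §4.2; [MazurTate1991] §1 (the `σ`-function and `s₂`);
[SilvermanATAEC1994] V.1 Rem. 1.2, V.3; tree: parts 1–7a, lane A `…KernelO3Sigma`.
-/

noncomputable section

open scoped Classical Nat
open Filter Topology IsUltrametricDist PowerSeries
open WeierstrassCurve Literature.NumberTheory.EllipticCurves
open Literature.NumberTheory.EllipticCurves.SteinWuthrich2013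
open Literature.NumberTheory.EllipticCurves.TateCurve
open Literature.NumberTheory.EllipticCurves.Rank1Residual
open Summit.BirchSwinnertonDyer.Uniform.UI.O2
open Summit.BirchSwinnertonDyer.Rank1Residual.X11b.RegMult.Rung62310y1

namespace Summit.BirchSwinnertonDyer.Rank1Residual.X11b.RegMult.HeightLogNumerator

/-! ### §18 The exact second-order law -/

section Exact

variable {W : WeierstrassCurve ℚ}

/-- **THE EXACT SECOND-ORDER LAW OF THE `3`-ADIC HEIGHT.** For `W/ℚ` globally minimal with multiplicative
reduction at `3`, any `q ∈ ℚ₃` with `‖q‖₃ < 1` and any rational affine point `P = (x, y)` of level `k ≥ 2`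
(`‖z(P)‖₃ ≤ 3⁻²`, i.e. `3⁴ ∣ den x`): **`‖ĥ₃(P) − log₃(num x) + κ_E·(den x)/(num x)‖₃ ≤ ‖x‖₃⁻²`** with the EXACT
curve constant **`κ_E = (C⁻²·E₂(q) − b₂)/12`**, `E₂(q) = 1 − 24·s₁(q)` (`s₁ = tateS 1`, `= Σ qⁿ/(1−qⁿ)²`),
`C² = uniformisationScaleSq W 3 q`. Precision `3^{−4k}` uniformly in the Kodaira type; `κ_E` is a `3`-adic
integer (part 7c) congruent to the rational constants of parts 3b/6b modulo `q`, `q²`.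
[cite: SteinWuthrich2013, §4.1 eq. (4.1), §4.2] [cite: SilvermanATAEC1994, Thm. V.3.1 (b), Remark V.1.2] -/
theorem norm_heightFourOneCoord_sub_padicLog_num_add_kappaE_mul_le [W.IsElliptic] [W.IsGloballyMinimal]
    (hW : Mult W 3) {q : ℚ_[3]} (hq : ‖q‖ < 1) {x y : ℚ} (hxy : W.toAffine.Nonsingular x y)
    (hx : 1 < ‖(x : ℚ_[3])‖) (hz9 : ‖-(x : ℚ_[3]) / y‖ ≤ 1 / 9) :
    ‖heightFourOneCoord W 3 q x y - padicLog 3 ((x.num : ℚ) : ℚ_[3]) +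
        ((uniformisationScaleSq W 3 q)⁻¹ * (1 - 24 * tateS 1 q) - (W.baseChange ℚ_[3]).b₂) / 12 *
          (((x.den : ℚ) : ℚ_[3]) / ((x.num : ℚ) : ℚ_[3]))‖ ≤ ‖(x : ℚ_[3])‖⁻¹ ^ 2 := by
  -- the objects
  set X : ℚ_[3] := (x : ℚ_[3]) with hXdef
  set Y : ℚ_[3] := (y : ℚ_[3]) with hYdef
  set V : WeierstrassCurve ℚ_[3] := W.baseChange ℚ_[3] with hVdef
  set z : ℚ_[3] := -X / Y with hzdef
  set ℓ : ℚ_[3] := V.padicFormalLog z with hℓdef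
  set C2 : ℚ_[3] := uniformisationScaleSq W 3 q with hC2def
  set L : ℚ_[3] := logUnitParamSq W 3 q x y with hLdef
  set c : ℚ_[3] := coshOfSq L with hcdef
  set Pr : ℚ_[3] := ∏' n : ℕ, (1 - 2 * q ^ (n + 1) * c + q ^ (2 * (n + 1))) ^ 2 /
    (1 - q ^ (n + 1)) ^ 4 with hPrdef
  set K : ℚ_[3] := tateS 1 q with hKdef
  have hSig : tateSigmaValueSq W 3 q x y = C2 * (2 * (c - 1) * Pr) := rfl
  have hL : L = ℓ ^ 2 / C2 := rfl
  -- basic norms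
  obtain ⟨hz, hz2⟩ := norm_neg_div_of_one_lt_norm (p := 3) hxy hx
  have hX0 : 0 < ‖X‖ := one_pos.trans hx
  have hX0' : X ≠ 0 := norm_pos_iff.mp hX0
  have hXinv : ‖X‖⁻¹ = ‖z‖ ^ 2 := hz2.symm
  have hzz : 0 < ‖z‖ := by
    have h : 0 < ‖z‖ ^ 2 := by rw [hz2]; exact inv_pos.mpr hX0
    rcases (norm_nonneg z).eq_or_lt with h0 | h0
    · rw [← h0] at h; norm_num at h
    · exact h0
  have hz0 : z ≠ 0 := norm_pos_iff.mp hzz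
  obtain ⟨hz1, h3z, h9z, h27z2, h3z2, hz2le, -, hr6, -, -, -, h3r5, hr6', -⟩ := deep_numerics ‖z‖ hzz hz9
  obtain ⟨h2n, h4n, h3n, h3i, h9i, h12i, -, -, -, -⟩ := padic_three_constants
  have h81 : 81 * ‖z‖ ^ 2 ≤ 1 := by
    calc 81 * ‖z‖ ^ 2 = (9 * ‖z‖) * (9 * ‖z‖) := by ring
      _ ≤ 1 * 1 := mul_le_mul h9z h9z (by positivity) zero_le_one
      _ = 1 := one_mul _
  have hC : ‖C2‖ = 1 := norm_uniformisationScaleSq_eq_one hW hq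
  have hC0 : C2 ≠ 0 := norm_pos_iff.mp (by rw [hC]; exact one_pos)
  have hCi : ‖C2⁻¹‖ = 1 := by rw [norm_inv, hC, inv_one]
  have heq : V.toAffine.Equation X Y := (nonsingular_ratCast (p := 3) hxy).left
  obtain ⟨hsq, hxyn⟩ := V.norm_sq_eq_norm_cube heq hx
  have hY0 : Y ≠ 0 := norm_pos_iff.mp (hX0.trans hxyn)
  have hd0 : ((x.den : ℚ) : ℚ_[3]) ≠ 0 := by exact_mod_cast x.den_nz
  have hS0 := tateSigmaValueSq_ne_zero (p := 3) (by norm_num) hW hq hxy hx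
  have hnum : ((x.num : ℚ) : ℚ_[3]) = X * ((x.den : ℚ) : ℚ_[3]) := by
    rw [hXdef, ← Rat.cast_mul, Rat.mul_den_eq_num]
  -- the scale facts
  obtain ⟨hb2n, hb4n, -⟩ : ‖V.b₂‖ ≤ 1 ∧ ‖V.b₄‖ ≤ 1 ∧ ‖V.b₆‖ ≤ 1 := by
    have h := V.eq_map_integralModel
    refine ⟨?_, ?_, ?_⟩
    · have e := congrArg WeierstrassCurve.b₂ h
      rw [map_b₂] at e; rw [← e]; exact PadicInt.norm_le_one _
    · have e := congrArg WeierstrassCurve.b₄ h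
      rw [map_b₄] at e; rw [← e]; exact PadicInt.norm_le_one _
    · have e := congrArg WeierstrassCurve.b₆ h
      rw [map_b₆] at e; rw [← e]; exact PadicInt.norm_le_one _
  have hCb : ‖C2⁻¹ - V.b₂‖ ≤ 1 / 3 := norm_inv_scaleSq_sub_b₂_le hW hq
  have hq3 : ‖q‖ ≤ 3⁻¹ := by
    have h := norm_le_inv_of_norm_lt_one hq
    exact h.trans (by norm_num)
  have hc4def : V.c₄ = V.b₂ ^ 2 - 24 * V.b₄ := rfl
  -- the Lambert constant and the corrected scale `C' = C⁻²·E₂(q)`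
  have hK : ‖K‖ ≤ ‖q‖ := norm_tateS_one_le hq
  have hC'1 : ‖C2⁻¹ * (1 - 24 * K)‖ = 1 := norm_lambertScale_eq_one hCi hK hq
  have hC'b : ‖C2⁻¹ * (1 - 24 * K) - V.b₂‖ ≤ 1 / 3 := norm_lambertScale_sub_le hCi hK hq3 hCb
  have hδ : ‖((C2⁻¹ * (1 - 24 * K)) ^ 2 - C2⁻¹ ^ 2) / 1440‖ ≤ 1 :=
    norm_lambertScale_sq_sub_sq_div_le hCi hK hq3
  -- the three logarithms
  have hlog1 : ‖padicLog 3 (X * ℓ ^ 2) - (-(V.b₂ / 12) * ℓ ^ 2 + (V.c₄ / 240 - V.b₂ ^ 2 / 288) * ℓ ^ 4)‖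
      ≤ ‖z‖ ^ 4 := by
    have h := norm_padicLog_x_mul_formalLog_sq_sub_le V heq hx hz9
    rw [hXinv] at h
    exact h.trans_eq (by ring)
  have hXℓ : ‖X * ℓ ^ 2 - 1 + V.b₂ / 12 * ℓ ^ 2 - V.c₄ / 240 * ℓ ^ 4‖ ≤ ‖z‖ ^ 4 := by
    have h := norm_x_mul_formalLog_sq_sub_le V heq hx hz9
    rw [hXinv] at h
    exact h.trans_eq (by ring)
  have hℓτ := norm_padicFormalLog_sub_cubic_le_pow_four V (hz9.trans (by norm_num))
  have hℓn : ‖ℓ‖ = ‖z‖ := by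
    obtain ⟨ha1, ha2, -, -, -⟩ := V.norm_coeffs_le_one
    have hw : ‖ℓ - z‖ ≤ ‖z‖ ^ 2 := by
      have e : ℓ - z = (ℓ - (z + (2 : ℚ_[3])⁻¹ * V.a₁ * z ^ 2 + (3 : ℚ_[3])⁻¹ * (V.a₁ ^ 2 + V.a₂) * z ^ 3)) +
          ((2 : ℚ_[3])⁻¹ * V.a₁ * z ^ 2 + (3 : ℚ_[3])⁻¹ * (V.a₁ ^ 2 + V.a₂) * z ^ 3) := by ring
      rw [e]
      refine (norm_add_le_max _ _).trans (max_le (hℓτ.trans ?_) ((norm_add_le_max _ _).trans (max_le ?_ ?_)))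
      · calc ‖z‖ ^ 4 = ‖z‖ ^ 2 * ‖z‖ ^ 2 := by ring
          _ ≤ ‖z‖ ^ 2 * 1 := by gcongr; exact pow_le_one₀ (norm_nonneg _) hz1
          _ = ‖z‖ ^ 2 := mul_one _
      · rw [norm_mul, norm_mul, norm_inv, h2n, inv_one, one_mul, norm_pow]
        calc ‖V.a₁‖ * ‖z‖ ^ 2 ≤ 1 * ‖z‖ ^ 2 := by gcongr
          _ = ‖z‖ ^ 2 := one_mul _
      · rw [norm_mul, norm_mul, h3i, norm_pow]
        have ha12 : ‖V.a₁ ^ 2 + V.a₂‖ ≤ 1 := (norm_add_le_max _ _).trans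
          (max_le (by rw [norm_pow]; exact pow_le_one₀ (norm_nonneg _) ha1) ha2)
        calc 3 * ‖V.a₁ ^ 2 + V.a₂‖ * ‖z‖ ^ 3 ≤ 3 * 1 * ‖z‖ ^ 3 := by gcongr
          _ = (3 * ‖z‖) * ‖z‖ ^ 2 := by ring
          _ ≤ 1 * ‖z‖ ^ 2 := by gcongr
          _ = ‖z‖ ^ 2 := one_mul _
    rw [show ℓ = z + (ℓ - z) by ring]
    have hzlt : ‖z‖ ^ 2 < ‖z‖ := by
      calc ‖z‖ ^ 2 = ‖z‖ * ‖z‖ := sq _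
        _ < 1 * ‖z‖ := mul_lt_mul_of_pos_right (by linarith) hzz
        _ = ‖z‖ := one_mul _
    have hlt : ‖ℓ - z‖ < ‖z‖ := lt_of_le_of_lt hw hzlt
    rw [norm_add_eq_max_of_norm_ne_norm hlt.ne', max_eq_left hlt.le]
  have hℓ0 : ℓ ≠ 0 := norm_pos_iff.mp (by rw [hℓn]; exact hzz)
  have hLn : ‖L‖ = ‖z‖ ^ 2 := by rw [hL, norm_div, norm_pow, hℓn, hC, div_one]
  have hL0 : L ≠ 0 := norm_pos_iff.mp (by rw [hLn]; positivity)
  have hL81 : ‖L‖ ≤ 1 / 81 := by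
    rw [hLn]
    calc ‖z‖ ^ 2 = ‖z‖ * ‖z‖ := sq _
      _ ≤ (1 / 9) * (1 / 9) := mul_le_mul hz9 hz9 (norm_nonneg _) (by norm_num)
      _ = 1 / 81 := by norm_num
  have hlog2 : ‖padicLog 3 (2 * (c - 1) / L) - (L / 12 - L ^ 2 / 1440)‖ ≤ 81 * ‖L‖ ^ 3 :=
    norm_padicLog_two_mul_coshOfSq_sub_one_div_sub_le hL0 hL81
  have hc1 : ‖c - 1‖ ≤ ‖L‖ := by
    have hL' : ‖L‖ ≤ ((3 : ℝ)⁻¹) ^ 2 := hL81.trans (by norm_num)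
    obtain ⟨R, hR, hRle⟩ := coshOfSq_eq_one_add_half_add (p := 3) (by norm_num) hL'
    rw [hcdef, hR, show 1 + L / 2 + R - 1 = L / 2 + R by ring]
    refine (norm_add_le_max _ _).trans (max_le ?_ (hRle.trans ?_))
    · rw [div_eq_mul_inv, norm_mul, norm_inv, h2n, inv_one, mul_one]
    · calc ‖L‖ * ((3 : ℕ) : ℝ)⁻¹ ≤ ‖L‖ * 1 := by gcongr; norm_num
        _ = ‖L‖ := mul_one _
  have hcn : ‖c‖ ≤ 1 := by
    have hL' : ‖L‖ ≤ ((3 : ℝ)⁻¹) ^ 2 := hL81.trans (by norm_num)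
    exact (norm_coshOfSq_eq_one (p := 3) (by norm_num) hL').le
  have hPr : ‖Pr - 1‖ ≤ ‖q‖ * ‖z‖ ^ 2 := by
    refine (norm_tprod_tateSigmaSq_factor_sub_one_le_mul hq hcn).trans ?_
    rw [← hLn]; gcongr
  have hPr1 : ‖1 - Pr‖ < 1 := by
    rw [norm_sub_rev]; refine hPr.trans_lt ?_
    calc ‖q‖ * ‖z‖ ^ 2 ≤ 1 * ‖z‖ ^ 2 := mul_le_mul_of_nonneg_right hq.le (by positivity)
      _ = ‖z‖ ^ 2 := one_mul _
      _ ≤ ‖z‖ := hz2le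
      _ < 1 := lt_of_le_of_lt hz9 (by norm_num)
  -- the sigma product to ALL orders in `q` (part 7a)
  have hPrK : ‖Pr - (1 - 4 * (c - 1) * K)‖ ≤ ‖q‖ ^ 2 * ‖c - 1‖ ^ 2 :=
    norm_tprod_tateSigmaSq_factor_sub_lambert_le hq hcn
  have hlogPr : ‖padicLog 3 Pr - (Pr - 1)‖ ≤ (‖q‖ * ‖z‖ ^ 2) ^ 2 := by
    have hu : ‖Pr - 1‖ ≤ 1 / 3 := hPr.trans (by
      calc ‖q‖ * ‖z‖ ^ 2 ≤ 3⁻¹ * 1 := mul_le_mul hq3 (hz2le.trans hz1) (by positivity) (by norm_num)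
        _ = 1 / 3 := by norm_num)
    have h := norm_padicLog_one_add_sub_le_sq hu
    rw [add_sub_cancel] at h
    exact h.trans (by gcongr)
  have hcL : ‖2 * (c - 1) - L‖ ≤ 3 * ‖L‖ ^ 2 :=
    norm_two_mul_coshOfSq_sub_one_sub_le (hL81.trans (by norm_num))
  have hK4 : ‖padicLog 3 Pr + 2 * K * L‖ ≤ ‖z‖ ^ 4 :=
    exact_logPr hq3 hLn hK hc1 hPrK hlogPr hcL
  have hPr0 : Pr ≠ 0 := by
    intro h; rw [h, sub_zero, norm_one] at hPr1; exact lt_irrefl _ hPr1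
  have hcr0 : 2 * (c - 1) / L ≠ 0 := by
    intro h
    have h' := hlog2
    rw [h, padicLog_zero] at h'
    -- `‖L/12 − L²/1440‖ = 3‖L‖ > 81‖L‖³`
    have h1440 : ‖(1440 : ℚ_[3])⁻¹‖ = 9 := by
      have h160 : ‖(160 : ℚ_[3])‖ = 1 := by
        simpa using Padic.norm_natCast_eq_one_iff.mpr (show Nat.Coprime 3 160 by decide)
      rw [show (1440 : ℚ_[3]) = 160 * (3 * 3) by norm_num, mul_inv, mul_inv, norm_mul, norm_mul, h3i,
        norm_inv, h160]; norm_num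
    have hLpos : 0 < ‖L‖ := norm_pos_iff.mpr hL0
    have h3L1 : 3 * ‖L‖ < 1 := by linarith
    have hA : ‖L / 12‖ = 3 * ‖L‖ := by rw [div_eq_mul_inv, norm_mul, h12i, mul_comm]
    have hB : ‖L ^ 2 / 1440‖ < ‖L / 12‖ := by
      rw [hA, div_eq_mul_inv, norm_mul, h1440, norm_pow]
      calc ‖L‖ ^ 2 * 9 = (3 * ‖L‖) * (3 * ‖L‖) := by ring
        _ < 1 * (3 * ‖L‖) := mul_lt_mul_of_pos_right h3L1 (by positivity)
        _ = 3 * ‖L‖ := one_mul _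
    have hmain : ‖L / 12 - L ^ 2 / 1440‖ = 3 * ‖L‖ := by
      rw [sub_eq_add_neg, norm_add_eq_max_of_norm_ne_norm (by rw [norm_neg]; exact hB.ne'), norm_neg,
        max_eq_left hB.le, hA]
    rw [zero_sub, norm_neg, hmain] at h'
    have hlt : 81 * ‖L‖ ^ 3 < 3 * ‖L‖ := by
      calc 81 * ‖L‖ ^ 3 = (81 * ‖L‖ ^ 2) * ‖L‖ := by ring
        _ ≤ (81 * (1 / 81) ^ 2) * ‖L‖ := by gcongr
        _ < 3 * ‖L‖ := mul_lt_mul_of_pos_right (by norm_num) hLpos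
    linarith
  -- `ĥ − log num = −log(x Σ²) = −(log(xℓ²) + log(2(c−1)/L) + log Π)`
  have hXℓ0 : X * ℓ ^ 2 ≠ 0 := mul_ne_zero hX0' (pow_ne_zero 2 hℓ0)
  have hdecomp : heightFourOneCoord W 3 q x y - padicLog 3 ((x.num : ℚ) : ℚ_[3]) =
      -(padicLog 3 (X * ℓ ^ 2) + padicLog 3 (2 * (c - 1) / L) + padicLog 3 Pr) := by
    have hprod : X * tateSigmaValueSq W 3 q x y = (X * ℓ ^ 2) * (2 * (c - 1) / L) * Pr := by
      rw [hSig, hL]; field_simp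
    rw [heightFourOneCoord_eq, hnum, padicLog_mul_holds 3 hX0' hd0,
      show padicLog 3 ((x.den : ℚ) : ℚ_[3]) - padicLog 3 (tateSigmaValueSq W 3 q x y) -
        (padicLog 3 X + padicLog 3 ((x.den : ℚ) : ℚ_[3])) =
        -(padicLog 3 X + padicLog 3 (tateSigmaValueSq W 3 q x y)) by ring,
      ← padicLog_mul_holds 3 hX0' hS0, hprod, padicLog_mul_holds 3 (mul_ne_zero hXℓ0 hcr0) hPr0,
      padicLog_mul_holds 3 hXℓ0 hcr0]
  -- conversion `ℓ² → x⁻¹` at the corrected scale `C'`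
  have hXi2 : ‖X⁻¹‖ = ‖z‖ ^ 2 := by rw [norm_inv, hXinv]
  clear_value X Y z ℓ C2 L c Pr K
  have hXℓ' : ‖X * ℓ ^ 2 - 1 + V.b₂ / 12 * ℓ ^ 2 - (V.b₂ ^ 2 - 24 * V.b₄) / 240 * ℓ ^ 4‖ ≤ ‖z‖ ^ 4 := by
    rw [← hc4def]; exact hXℓ
  obtain ⟨hK1, hK2, hK3⟩ := deep_conversion hX0' hXi2 hℓn hzz hz9 hb2n hb4n hC'1 hC'b hXℓ'
  rw [← hc4def] at hK2 hK3
  -- the exact regrouping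
  have hfin : heightFourOneCoord W 3 q x y - padicLog 3 ((x.num : ℚ) : ℚ_[3]) +
      (C2⁻¹ * (1 - 24 * K) - V.b₂) / 12 * (((x.den : ℚ) : ℚ_[3]) / ((x.num : ℚ) : ℚ_[3])) =
      -(padicLog 3 (X * ℓ ^ 2) - (-(V.b₂ / 12) * ℓ ^ 2 + (V.c₄ / 240 - V.b₂ ^ 2 / 288) * ℓ ^ 4))
      - (padicLog 3 (2 * (c - 1) / L) - (L / 12 - L ^ 2 / 1440))
      - (C2⁻¹ * (1 - 24 * K) - V.b₂) / 12 * (ℓ ^ 2 - (X⁻¹ - V.b₂ / 12 * X⁻¹ ^ 2))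
      - (6 * V.c₄ - 5 * V.b₂ ^ 2 - (C2⁻¹ * (1 - 24 * K)) ^ 2) / 1440 * (ℓ ^ 4 - X⁻¹ ^ 2)
      - ((6 * V.c₄ - 5 * V.b₂ ^ 2 - (C2⁻¹ * (1 - 24 * K)) ^ 2) / 1440 -
          (C2⁻¹ * (1 - 24 * K) - V.b₂) / 12 * (V.b₂ / 12)) * X⁻¹ ^ 2
      - ((C2⁻¹ * (1 - 24 * K)) ^ 2 - C2⁻¹ ^ 2) / 1440 * ℓ ^ 4
      - (padicLog 3 Pr + 2 * K * L) := by
    rw [hdecomp, hnum, hL]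
    field_simp
    ring
  rw [hfin, hXinv, show (‖z‖ ^ 2) ^ 2 = ‖z‖ ^ 4 by ring]
  refine (norm_sub_le_max₃ _ _).trans (max_le ((norm_sub_le_max₃ _ _).trans (max_le
    ((norm_sub_le_max₃ _ _).trans (max_le ((norm_sub_le_max₃ _ _).trans (max_le
    ((norm_sub_le_max₃ _ _).trans (max_le ((norm_sub_le_max₃ _ _).trans (max_le ?_ ?_)) ?_)) ?_)) ?_)) ?_)) ?_)
  · rw [norm_neg]; exact hlog1
  · refine hlog2.trans ?_
    rw [hLn]
    calc 81 * (‖z‖ ^ 2) ^ 3 = (81 * ‖z‖ ^ 2) * ‖z‖ ^ 4 := by ring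
      _ ≤ 1 * ‖z‖ ^ 4 := by gcongr
      _ = ‖z‖ ^ 4 := one_mul _
  · exact hK1
  · exact hK2
  · exact hK3
  · rw [norm_mul, norm_pow, hℓn]
    calc ‖((C2⁻¹ * (1 - 24 * K)) ^ 2 - C2⁻¹ ^ 2) / 1440‖ * ‖z‖ ^ 4 ≤ 1 * ‖z‖ ^ 4 := by gcongr
      _ = ‖z‖ ^ 4 := one_mul _
  · exact hK4

end Exact

end Summit.BirchSwinnertonDyer.Rank1Residual.X11b.RegMult.HeightLogNumerator

end
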